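import Summits.BirchSwinnertonDyer.BirchSwinnertonDyer.Theorems.ErratumRoadFiveNonSurjCornerKolyJProp44PairSelmer
import Summits.BirchSwinnertonDyer.BirchSwinnertonDyer.Theorems.GenusKolyvaginAtTwoKolyvaginRelationAtTwoHeegnerInputs
import HarnessLib

/-!
# Route `GenusKolyvaginAtTwo`, LINE 6, Q2 `KolyvaginRelationAtTwo` (stmt-BirchSwinnertonDyer-24880):
# McCallum Prop. 4.4 «in particular» AT `p = 2` for TWO COMPATIBLE concrete Kolyvagin–Heegner data at
# Zhang–Kolyvagin levels, modulo the congruence (γ) for the pair (seat gk2-p2 g7; helper)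

The seat's g5 END `GenusExact.zsmul_kolyvaginClass_localOrders_of_heegnerInputs` gives BOTH conjuncts of
Q2 at every prime for ABSTRACT Euler data with labelled inputs `hrel`, `hy'P`, `hES`, `hsplit`, `hram`
(+ Frobenius clause), `hsel₂`. THIS file is the CONCRETE-currency dictionary — the `p = 2` twin of
bsd-stepL corner-p1's `Prop44.zsmul_kolyvaginClass_mem_selmerLocalKer_iff_of_compat` (`p` odd): for data
`d` (level `n`), `d₀` (level `n/ℓ`) COMPATIBLE in the currency of the typed fact
`McCallum1991.prop44_localOrder_kolyvaginClass_mul_eq` (= Q2's binders), every labelled input except (γ) is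
SUPPLIED from the ring class tower (level data, G1, coherence, the PROVED trace relation Prop. 3.7 (1),
`hsplit`, `hram`, the Frobenius clause via the new §1, `hsel₂` by McCallum Lemma 4.3 at `λ ∤ n/ℓ`).
Remaining hypotheses: (γ) for the pair (PRINT: `GrossLMS1991.prop37_2_reductionCongruence_inert`) and
McCallum's standing inputs `hA`/`hA₀`, `hPt`/`hPt₀` (THEOREMS under Q2's binders:
`GenusExact.isAdmissible_pointsSubgroup_two_of_heegner`, `Prop44.toGeomPoints_derivedPoint_mem_invPoints`).
HONEST FRAMING: helper (no definition, no named fact, no `sorry`); conditional on (γ); nothing is closed;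
BSD is not proved by any of this. References: [McCallumLMS1991] §4 (4)–(6), Lemma 4.3, Prop. 4.4;
[GrossLMS1991] §3, Prop. 3.6, 3.7, §4 (4.1), Lemma 4.3, Prop. 6.2; [WZhang2014] (xii); [Cox2013] §9.A.
-/

set_option autoImplicit false
set_option linter.dupNamespace false

noncomputable section

open scoped Classical

namespace Summit.BirchSwinnertonDyer.BirchSwinnertonDyer.Theorems.GenusExact

open WeierstrassCurve Field NumberField IsDedekindDomain Finset
open Literature.NumberTheory.EllipticCurves Literature.NumberTheory.GaloisRepresentations
open Literature.NumberTheory.EllipticCurves.KolyvaginCocycle Literature.NumberTheory.EllipticCurves.KolyvaginEuler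
open Literature.NumberTheory.EllipticCurves.RingClassField Literature.NumberTheory.EllipticCurves.ModularForms
open Summit.BirchSwinnertonDyer.Rank1Residual.X11b Summit.BirchSwinnertonDyer.Rank1Residual.X11b.KolyvaginTowerLift
open Summit.BirchSwinnertonDyer.Rank1Residual.X11b.RingClassTower Summit.BirchSwinnertonDyer.Rank1Residual.X11b.KolyvaginH44
open Summit.BirchSwinnertonDyer.BirchSwinnertonDyer.Theorems.Prop44

-- `K : Type`: the tree's ring-class class field theory is universe `0`.
variable {K : Type} [Field K] [NumberField K] {W : WeierstrassCurve ℚ}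

/-! ## §1 A Frobenius at a prime split in `K[f]` fixes the elements of `K[n]` that lie in `K[f]` -/

/-- **Frobenius at `λ = (ℓ)`, `ℓ ∤ f`, fixes `K[n] ∩ K[f]` through ANY `K`-embedding `e : K[n] → K̄`**
(Frobenius twin of x11b3's `smul_algHom_ringClassField_eq_self_of_mem_inertia`): `(ℓ)` splits completely
in `K[f]` (`mem_splitPrimes_ringClassField_of_span_natCast`), so `F` fixes `φ(K[f])` for every `K`-embedding
`φ` (`smul_algHom_eq_self_of_mem_splitPrimes`); restrict `e` to `K[n] ∩ K[f] ∋ x` and extend.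
[cite: GrossLMS1991, §3 (p. 240: λ splits completely in K_m)] [cite: Cox2013, §9.A Thm. 9.2] -/
theorem smul_algHom_ringClassField_eq_self_of_isArithFrobAt (hK : IsImaginaryQuadratic K)
    (ι : K →+* ℂ) {n f : ℕ} (hf : f ≠ 0) (e : ringClassField K ι n →ₐ[K] AlgebraicClosure K)
    {v : HeightOneSpectrum (𝓞 K)} {ℓ : ℕ} (hvℓ : v.asIdeal = Ideal.span {((ℓ : ℕ) : 𝓞 K)})
    (hℓf : Nat.Coprime ℓ f) {𝔓 : Ideal (absIntegers (𝓞 K) K)} (h𝔓 : 𝔓 ∈ v.primesAbove)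
    {F : absoluteGaloisGroup K} (hF : IsArithFrobAt (𝓞 K) F 𝔓)
    {x : ringClassField K ι n} (hx : (x : ℂ) ∈ ringClassField K ι f) : F • e x = e x := by
  haveI := (finiteDimensional_and_isGalois_ringClassField hK ι hf).1
  haveI := (finiteDimensional_and_isGalois_ringClassField hK ι hf).2
  haveI : NumberField (ringClassField K ι f) := NumberField.of_module_finite K _
  have hvs : v ∈ splitPrimes K (ringClassField K ι f) :=
    mem_splitPrimes_ringClassField_of_span_natCast hK ι hf hvℓ hℓf
  -- the field `F₀ = K[n] ∩ K[f] ⊂ ℂ`, between `K` and `K[f]`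
  have hιF₀ : ∀ k : K, ι k ∈ ringClassField K ι n ⊓ ringClassField K ι f := fun k ↦
    Subfield.mem_inf.mpr ⟨apply_mem_ringClassField ι n k, apply_mem_ringClassField ι f k⟩
  letI : Algebra K ↥(ringClassField K ι n ⊓ ringClassField K ι f) :=
    (ι.codRestrict (ringClassField K ι n ⊓ ringClassField K ι f) hιF₀).toAlgebra
  letI : Algebra ↥(ringClassField K ι n ⊓ ringClassField K ι f) (ringClassField K ι f) :=
    (Subfield.inclusion
      (inf_le_right : ringClassField K ι n ⊓ ringClassField K ι f ≤ ringClassField K ι f)).toAlgebra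
  haveI : IsScalarTower K ↥(ringClassField K ι n ⊓ ringClassField K ι f) (ringClassField K ι f) :=
    IsScalarTower.of_algebraMap_eq fun k ↦ Subtype.ext rfl
  haveI : Algebra.IsAlgebraic ↥(ringClassField K ι n ⊓ ringClassField K ι f)
      (ringClassField K ι f) :=
    Algebra.IsAlgebraic.tower_top (K := K) ↥(ringClassField K ι n ⊓ ringClassField K ι f)
  -- `e` restricted to `F₀`, as a `K`-algebra map
  have hincl : ∀ k : K, Subfield.inclusion
      (inf_le_left : ringClassField K ι n ⊓ ringClassField K ι f ≤ ringClassField K ι n)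
      (algebraMap K ↥(ringClassField K ι n ⊓ ringClassField K ι f) k) =
        algebraMap K (ringClassField K ι n) k := fun k ↦ Subtype.ext rfl
  let e₀ : ↥(ringClassField K ι n ⊓ ringClassField K ι f) →ₐ[K] AlgebraicClosure K :=
    { (e.toRingHom.comp (Subfield.inclusion
        (inf_le_left : ringClassField K ι n ⊓ ringClassField K ι f ≤ ringClassField K ι n))) with
      commutes' := fun k ↦ by
        change e (Subfield.inclusion _ (algebraMap K _ k)) = _
        rw [hincl, e.commutes] }
  have he₀ : ∀ z, e₀ z = e (Subfield.inclusion
      (inf_le_left : ringClassField K ι n ⊓ ringClassField K ι f ≤ ringClassField K ι n) z) :=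
    fun _ ↦ rfl
  -- extend it to a `K`-embedding `φ` of `K[f]`
  obtain ⟨φ, hφ⟩ := IsAlgClosed.surjective_restrictDomain_of_isAlgebraic (K := K)
    (L := ↥(ringClassField K ι n ⊓ ringClassField K ι f)) (M := AlgebraicClosure K)
    (E := ringClassField K ι f) e₀
  have hφ' : φ.restrictDomain ↥(ringClassField K ι n ⊓ ringClassField K ι f) = e₀ := hφ
  have hxF : (x : ℂ) ∈ ringClassField K ι n ⊓ ringClassField K ι f :=
    Subfield.mem_inf.mpr ⟨x.2, hx⟩
  have hφx : φ ⟨(x : ℂ), hx⟩ = e x := by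
    have h1 : (⟨(x : ℂ), hx⟩ : ringClassField K ι f) =
        algebraMap (↥(ringClassField K ι n ⊓ ringClassField K ι f)) (ringClassField K ι f)
          ⟨x, hxF⟩ := Subtype.ext rfl
    have h2 : φ (algebraMap (↥(ringClassField K ι n ⊓ ringClassField K ι f))
        (ringClassField K ι f) ⟨x, hxF⟩) = (φ.restrictDomain
          ↥(ringClassField K ι n ⊓ ringClassField K ι f)) ⟨x, hxF⟩ := rfl
    have h3 : Subfield.inclusion
        (inf_le_left : ringClassField K ι n ⊓ ringClassField K ι f ≤ ringClassField K ι n)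
        ⟨x, hxF⟩ = x := Subtype.ext rfl
    rw [h1, h2, hφ', he₀, h3]
  -- Frobenius at a completely split prime fixes `φ(K[f])` pointwise
  have key := smul_algHom_eq_self_of_mem_splitPrimes φ hvs h𝔓 hF ⟨(x : ℂ), hx⟩
  rwa [hφx] at key

/-! ## §2 Both local order equalities at `2` for two compatible concrete data, modulo (γ) -/

set_option maxHeartbeats 1600000 in
/-- **McCallum 1991, Prop. 4.4 «in particular» AT `p = 2` for two COMPATIBLE concrete Kolyvagin–Heegner
data at Zhang–Kolyvagin levels, modulo (γ) for the pair.** `W/ℚ` globally minimal, `K` imaginary quadratic,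
`d_K < −4`, Heegner hypothesis for `N_E`, a frame `(Dt, β, ι)`, `n` square-free with Zhang–Kolyvagin prime
factors AT `2` of index `≥ M`, `ℓ ∣ n`, `m = n/ℓ`, data `d` (level `n`), `d₀` (level `m`) compatible
(`hσ`, `hS₁`, `hS₂`, `hemb` — Q2's binders), (γ) for this pair (`hγ`), and `hA`, `hA₀`, `hPt`, `hPt₀`:
at `λ ∋ ℓ`, for every `k : ℤ`, (`k c_M(n) ∈ Sel_λ ↔ k c_M(n)_λ = 0`) ∧ (`k c_M(n)_λ = 0 ↔ k c_M(m)_λ = 0`)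
for `d.kolyvaginClass Nat.prime_two M`, `d₀.kolyvaginClass Nat.prime_two M` — the two conjuncts of
`KolyvaginRelationAtTwo`. [cite: McCallumLMS1991, Prop. 4.4 «In particular» (p. 301), Lemma 4.3, §4 (4)–(6)]
[cite: GrossLMS1991, Prop. 3.7 (1)(2), Prop. 3.6, §4 (4.1), Lemma 4.3, Prop. 6.2 (2)] [cite: WZhang2014, Notations (xii)] -/
theorem zsmul_kolyvaginClass_localOrders_of_compat_two [W.IsElliptic] [W.IsGloballyMinimal]
    [NeZero (W.conductorNorm ℤ)]
    (hK : IsImaginaryQuadratic K) (ι : K →+* ℂ) (hD : NumberField.discr K < -4)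
    (hH : SatisfiesHeegnerHypothesis (W.conductorNorm ℤ) K)
    (Dt : ModularParametrizationData W (W.conductorNorm ℤ)) {β : ℤ} {M : ℕ}
    {n : ℕ} (hn : Squarefree n)
    (hkol : ∀ q ∈ n.primeFactors, Zhang2014.IsKolyvaginPrime (W.conductorNorm ℤ) W K 2 q ∧
      M ≤ Zhang2014.kolyvaginIndex W 2 q)
    {ℓ : ℕ} (hℓ : ℓ ∈ n.primeFactors) {m : ℕ} (hmn : n / ℓ = m)
    (d : KolyvaginHeegnerData Dt β ι n) (d₀ : KolyvaginHeegnerData Dt β ι m)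
    (hσ : ∀ q ∈ m.primeFactors, ∀ (x : ringClassField K ι m) (x' : ringClassField K ι n),
      (x : ℂ) = x' → ((d.σ q x' : ringClassField K ι n) : ℂ) = (d₀.σ q x : ℂ))
    (hS₁ : ∀ s ∈ d₀.S, ∃ s' ∈ d.S, ∀ (x : ringClassField K ι m) (x' : ringClassField K ι n),
      (x : ℂ) = x' → ((s' x' : ringClassField K ι n) : ℂ) = (s x : ℂ))
    (hS₂ : ∀ s' ∈ d.S, ∃ s ∈ d₀.S, ∀ (x : ringClassField K ι m) (x' : ringClassField K ι n),
      (x : ℂ) = x' → ((s' x' : ringClassField K ι n) : ℂ) = (s x : ℂ))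
    (hemb : ∀ (x : ringClassField K ι m) (x' : ringClassField K ι n),
      (x : ℂ) = x' → d.emb x' = d₀.emb x)
    (hγ : ∀ [Fact ℓ.Prime] (hΔ : ¬ (ℓ : ℤ) ∣ minimalDiscriminantInt W)
      (φ₀ : absoluteGaloisGroup (ZMod ℓ)), (∀ x : AlgebraicClosure (ZMod ℓ), φ₀ • x = x ^ ℓ) →
      ∀ (hle : ringClassField K ι m ≤ ringClassField K ι n)
        (γ : ringClassField K ι n ≃ₐ[ℚ] ringClassField K ι n), γ ∈ ringClassGal ι n →
        geomReduction hΔ ((RatClosure.pointsEquiv (K := K) W).symm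
            (d.toGeomPoints (pointGalHom W (ringClassField K ι n) γ d.y))) =
          φ₀ • geomReduction hΔ ((RatClosure.pointsEquiv (K := K) W).symm
            (d.toGeomPoints (pointGalHom W (ringClassField K ι n) γ
              (WeierstrassCurve.Affine.Point.map (W' := W)
                (letI : Algebra K ℂ := ι.toAlgebra; (RingClassField.inclusion ι hle).restrictScalars ℚ)
                d₀.y)))))
    (hA : IsAdmissible (absoluteGaloisGroup K) d.pointsSubgroup ((2 ^ M : ℕ) : ℤ))
    (hA₀ : IsAdmissible (absoluteGaloisGroup K) d₀.pointsSubgroup ((2 ^ M : ℕ) : ℤ))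
    (hPt : d.toGeomPoints d.derivedPoint ∈
      invPoints (absoluteGaloisGroup K) d.pointsSubgroup ((2 ^ M : ℕ) : ℤ))
    (hPt₀ : d₀.toGeomPoints d₀.derivedPoint ∈
      invPoints (absoluteGaloisGroup K) d₀.pointsSubgroup ((2 ^ M : ℕ) : ℤ))
    (v : HeightOneSpectrum (𝓞 K)) (hv : (ℓ : 𝓞 K) ∈ v.asIdeal) (k : ℤ) :
    (k • d.kolyvaginClass Nat.prime_two M ∈
        selmerLocalKer (W.baseChange K) (v.adicCompletion K) ((2 ^ M : ℕ) : ℤ) ↔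
      k • d.kolyvaginClass Nat.prime_two M ∈
        (W.baseChange K).torsionLocalKer (v.adicCompletion K) ((2 ^ M : ℕ) : ℤ)) ∧
    (k • d.kolyvaginClass Nat.prime_two M ∈
        (W.baseChange K).torsionLocalKer (v.adicCompletion K) ((2 ^ M : ℕ) : ℤ) ↔
      k • d₀.kolyvaginClass Nat.prime_two M ∈
        (W.baseChange K).torsionLocalKer (v.adicCompletion K) ((2 ^ M : ℕ) : ℤ)) := by
  subst hmn
  letI : Algebra K ℂ := ι.toAlgebra
  haveI : Fact (Nat.Prime 2) := ⟨Nat.prime_two⟩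
  set N : ℕ := W.conductorNorm ℤ with hNdef
  have hn0 : n ≠ 0 := Squarefree.ne_zero hn
  obtain ⟨hℓp, hℓn, -⟩ := Nat.mem_primeFactors.mp hℓ
  haveI : Fact ℓ.Prime := ⟨hℓp⟩
  have hdvd : n / ℓ ∣ n := Nat.div_dvd_of_dvd hℓn
  have hm0 : n / ℓ ≠ 0 := (Nat.div_pos (Nat.le_of_dvd (Nat.pos_of_ne_zero hn0) hℓn) hℓp.pos).ne'
  have hmn : n / ℓ ≠ n := (Nat.div_lt_self (Nat.pos_of_ne_zero hn0) hℓp.one_lt).ne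
  have hmsq : Squarefree (n / ℓ) := hn.squarefree_of_dvd hdvd
  have hℓm' : ¬ ℓ ∣ n / ℓ := not_dvd_div_of_squarefree_of_prime hn hℓp hℓn
  have hle : ringClassField K ι (n / ℓ) ≤ ringClassField K ι n := ringClassField_mono hK ι hdvd hn0
  have hinert : ∀ q ∈ n.primeFactors, (Ideal.span {(q : 𝓞 K)}).IsPrime :=
    fun q hq ↦ (hkol q hq).1.2.2.2.2.1
  have hND : IsCoprime (N : ℤ) (NumberField.discr K) :=
    KolyvaginAssembly.isCoprime_discr_of_satisfiesHeegnerHypothesis hK hH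
  have hℓK : Zhang2014.IsKolyvaginPrime N W K 2 ℓ := (hkol ℓ hℓ).1
  have hℓM : M ≤ Zhang2014.kolyvaginIndex W 2 ℓ := (hkol ℓ hℓ).2
  have hℓN : ¬ ℓ ∣ N := hℓK.2.1
  have hNn : Nat.Coprime N n :=
    KolyvaginH37Bridge.coprime_of_forall_not_dvd hn0 fun q hq ↦ (hkol q hq).1.2.1
  have hdiv : ∀ Q : geomPoints (W.baseChange K), ∃ R, ((2 ^ M : ℕ) : ℤ) • R = Q :=
    (W.baseChange K).zsmul_geomPoints_surjective_of_charZero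
      (by exact_mod_cast pow_ne_zero M two_ne_zero)
  -- the two-level family
  let R : ℕ → Prop := fun k ↦ k = n ∨ k = n / ℓ
  let dfam : (k : ℕ) → R k → KolyvaginHeegnerData Dt β ι k := fun k hk ↦
    if h : k = n then h ▸ d else (hk.resolve_left h) ▸ d₀
  have hRn : R n := Or.inl rfl
  have hRm : R (n / ℓ) := Or.inr rfl
  have hdfam_n : ∀ h : R n, dfam n h = d := fun h ↦ by simp only [dfam, dif_pos rfl]
  have hdfam_m : ∀ h : R (n / ℓ), dfam (n / ℓ) h = d₀ := fun h ↦ by simp only [dfam, dif_neg hmn]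
  have hsqR : ∀ k, R k → Squarefree k := by rintro k (rfl | rfl); exacts [hn, hmsq]
  have hinertR : ∀ k, R k → ∀ q ∈ k.primeFactors, (Ideal.span {(q : 𝓞 K)}).IsPrime := by
    rintro k (rfl | rfl) q hq
    exacts [hinert q hq, hinert q (Nat.primeFactors_mono hdvd hn0 hq)]
  -- the level data, at every level
  choose σ H f y π j e hord hj hπρ hfsec hHρ hdict hjunk using
    fun k ↦ exists_levelData_of (W := W) (Dt := Dt) (β := β) hK ι R hsqR hinertR dfam k
  -- `𝒢_k = ringClassGal ι k` is a finite commutative group acting on `E(K[k])` through `pointGalHom`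
  letI hcg : ∀ k, CommGroup (ringClassGal ι k) := fun k ↦
    { (inferInstance : Group (ringClassGal ι k)) with
      mul_comm := fun a b ↦ (isMulCommutative_ringClassGal' hK ι k).is_comm.comm a b }
  haveI hfin : ∀ k, Finite (ringClassGal ι k) := finite_ringClassGal hK ι
  letI act : ∀ k, DistribMulAction (ringClassGal ι k)
      ((W.baseChange (ringClassField K ι k)).toAffine.Point) := fun k ↦
    DistribMulAction.compHom _ ((pointGalHom W (ringClassField K ι k)).comp (ringClassGal ι k).subtype)
  letI hft : ∀ k, Fintype (ringClassGal ι k ⧸ H k) := fun k ↦ Fintype.ofFinite _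
  -- the inclusion `ρ_k : 𝒢_k ≤ Aut_ℚ(K[k])`
  set ρ : ∀ k, ringClassGal ι k →* (ringClassField K ι k ≃ₐ[ℚ] ringClassField K ι k) :=
    fun k ↦ (ringClassGal ι k).subtype with hρdef
  have hρ : ∀ k, Function.Injective (ρ k) := fun k ↦ (ringClassGal ι k).subtype_injective
  have hsmul : ∀ (k) (g : ringClassGal ι k) (Q : (W.baseChange (ringClassField K ι k)).toAffine.Point),
      g • Q = pointGalHom W (ringClassField K ι k) (ρ k g) Q := fun _ _ _ ↦ rfl
  have hj' : ∀ (k) (g : absoluteGaloisGroup K) (a : (W.baseChange (ringClassField K ι k)).toAffine.Point),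
      j k (π k g • a) = g • j k a := fun k g a ↦ by rw [hsmul]; exact hj k g a
  have hπρ' : ∀ (k) (τ : absoluteGaloisGroup K) (x : ringClassField K ι k),
      τ • e k x = e k (ρ k (π k τ) x) := fun k τ x ↦ hπρ k τ x
  -- the dictionary at the two levels
  have hjn : j n = d.toGeomPoints := by rw [(hdict n hRn).1, hdfam_n hRn]
  have hjm : j (n / ℓ) = d₀.toGeomPoints := by rw [(hdict (n / ℓ) hRm).1, hdfam_m hRm]
  have hyn : y n = d.y := by rw [(hdict n hRn).2.1, hdfam_n hRn]
  have hym : y (n / ℓ) = d₀.y := by rw [(hdict (n / ℓ) hRm).2.1, hdfam_m hRm]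
  have hσn : ∀ q ∈ n.primeFactors, ρ n (σ n q) = d.σ q := fun q hq ↦ by
    have h := (hdict n hRn).2.2.1 q hq
    rwa [hdfam_n hRn] at h
  have hσm : ∀ q ∈ (n / ℓ).primeFactors, ρ (n / ℓ) (σ (n / ℓ) q) = d₀.σ q := fun q hq ↦ by
    have h := (hdict (n / ℓ) hRm).2.2.1 q hq
    rwa [hdfam_m hRm] at h
  have hfSn : ∀ c, ρ n (f n c) ∈ d.S := fun c ↦ by
    have h := (hdict n hRn).2.2.2 c
    rwa [hdfam_n hRn] at h
  have hfSm : ∀ c, ρ (n / ℓ) (f (n / ℓ) c) ∈ d₀.S := fun c ↦ by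
    have h := (hdict (n / ℓ) hRm).2.2.2 c
    rwa [hdfam_m hRm] at h
  -- the abstract Kolyvagin point IS `P(k)` at the two levels (x11b3-p8's G1)
  have hbij : ∀ (k : ℕ) (dk : KolyvaginHeegnerData Dt β ι k), (∀ c, ρ k (f k c) ∈ dk.S) →
      Set.BijOn (fun c : ringClassGal ι k ⧸ H k ↦ ρ k (f k c)) Set.univ (dk.S : Set _) :=
    fun k dk hfS ↦ KolyvaginH37Bridge.bijOn_of_section_of_transversal (ρ k) (hρ k)
      (H := H k) (Γ := ringClassGal ι k) (G₁ := ringClassGalOver ι k 1) (hHρ k)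
      (S := (dk.S : Set _)) (fun s hs ↦ dk.S_subset s hs)
      (fun s hs ↦ ⟨⟨s, dk.S_subset s hs⟩, rfl⟩) dk.S_transversal (f k) (hfsec k) hfS
  have hPn : j n (kolyvaginPoint (σ n) n.primeFactors (f n) (y n)) = d.toGeomPoints d.derivedPoint := by
    rw [hjn, hyn]
    congr 1
    exact KolyvaginH37Bridge.map_kolyvaginPoint_eq_derivedPoint
      (pointGalHom W (ringClassField K ι n)) (ρ n) (AddMonoidHom.id _) (fun g a ↦ hsmul n g a)
      hn hσn (f n) (hbij n d hfSn) d.y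
  have hPm : j (n / ℓ) (kolyvaginPoint (σ (n / ℓ)) (n / ℓ).primeFactors (f (n / ℓ)) (y (n / ℓ))) =
      d₀.toGeomPoints d₀.derivedPoint := by
    rw [hjm, hym]
    congr 1
    exact KolyvaginH37Bridge.map_kolyvaginPoint_eq_derivedPoint
      (pointGalHom W (ringClassField K ι (n / ℓ))) (ρ (n / ℓ)) (AddMonoidHom.id _)
      (fun g a ↦ hsmul (n / ℓ) g a) hmsq hσm (f (n / ℓ)) (hbij (n / ℓ) d₀ hfSm) d₀.y
  -- the standing inputs `hA`, `hPt`, `hI` at every level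
  have hA' : ∀ k, IsAdmissible (absoluteGaloisGroup K) (j k).range ((2 ^ M : ℕ) : ℤ) := by
    intro k
    by_cases hk : R k
    · rcases hk with rfl | rfl
      · rw [hjn]; exact hA
      · rw [hjm]; exact hA₀
    · rw [hjunk k hk]
      refine ⟨fun g a ha ↦ ?_, fun a ha _ ↦ ?_⟩ <;> obtain ⟨x, hx⟩ := ha <;>
        rw [AddMonoidHom.zero_apply] at hx
      · rw [← hx, smul_zero]; exact AddSubgroup.zero_mem _
      · exact hx.symm
  have hPt' : ∀ k, j k (kolyvaginPoint (σ k) k.primeFactors (f k) (y k)) ∈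
      invPoints (absoluteGaloisGroup K) (j k).range ((2 ^ M : ℕ) : ℤ) := by
    intro k
    by_cases hk : R k
    · rcases hk with rfl | rfl
      · rw [hPn, hjn]; exact hPt
      · rw [hPm, hjm]; exact hPt₀
    · rw [hjunk k hk, AddMonoidHom.zero_apply]; exact AddSubgroup.zero_mem _
  have hI' := smul_kolyvaginPoint_eq_of_mem_localInertia (W := W) hK ι σ (fun k ↦ k.primeFactors) H f y
    π j hj' e ρ hρ hπρ'
  -- the pair guard and `hσρ` at the pair `(n, ℓ)`
  let Rp : ℕ → ℕ → Prop := fun k q ↦ k = n ∧ q = ℓ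
  have hσρ : ∀ k : ℕ, ∀ q ∈ k.primeFactors, Rp k q →
      (Subgroup.zpowers (σ k q)).map (ρ k) = ringClassGalOver ι k (k / q) := by
    rintro k q hq ⟨hk, hq'⟩
    subst k; subst q
    rw [MonoidHom.map_zpowers, hσn ℓ hℓ, d.zpowers_σ ℓ hℓ]
  have hgoodp : W.HasGoodReductionAtPrime ℓ :=
    KolyvaginH37Bridge.hasGoodReductionAtPrime_of_modularParametrizationData Dt hℓN
  -- ### the END's inputs at the pair
  -- the places: `v₀ = (ℓ)` of `ℚ` (good reduction), `λ = v` (good reduction), `λ ∤ n/ℓ`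
  obtain ⟨v₀, hv₀, hℓv₀⟩ := exists_ratPlace ℓ
  have hgood₀ : W.HasGoodReductionAt v₀ :=
    Summit.BirchSwinnertonDyer.Rank1Residual.X11b.Three.Koly.Method2.LocalFrob.hasGoodReductionAt_rat_of_not_dvd_conductorNorm
      W hℓp hℓN v₀ hℓv₀
  have hgood : (W.baseChange K).HasGoodReductionAt v :=
    (Summit.BirchSwinnertonDyer.Rank1Residual.JET.RingClassTransverse.hasGoodReductionAt_of_zhangKolyvagin
      W K Nat.prime_two hℓK v hv M).1
  have hmv : ((n / ℓ : ℕ) : 𝓞 K) ∉ v.asIdeal := fun h ↦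
    hℓm' (dvd_of_natCast_mem_of_isPrime_span hℓp hv h)
  have hvℓ : v.asIdeal = Ideal.span {((ℓ : ℕ) : 𝓞 K)} :=
    asIdeal_eq_span_of_natCast_mem hℓp hℓK.2.2.2.2.1 hv
  -- `hsel₂`: `c_M(n/ℓ)` is Selmer at `λ` (McCallum Lemma 4.3 / Gross Prop. 6.2 (1))
  obtain ⟨𝔐, h𝔐⟩ := v.localPrimesAbove_nonempty
  have hsel₂ := Summit.BirchSwinnertonDyer.Rank1Residual.X11b.Three.GrossBadPlace.kolyvaginClass_mem_selmerLocalKer_of_inertia_of_hasGoodReductionAt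
    (W.baseChange K) (hdiv := hdiv) (hA' (n / ℓ)) (hPt' (n / ℓ)) v hgood h𝔐 (hI' (n / ℓ) v hmv 𝔐 h𝔐)
  -- the witness `y' = y(n/ℓ)↑` read in `E(K[n])`
  set y₀ : (W.baseChange (ringClassField K ι n)).toAffine.Point :=
    WeierstrassCurve.Affine.Point.map (W' := W)
      ((RingClassField.inclusion ι hle).restrictScalars ℚ) d₀.y with hy₀
  -- (β1): the inter-level identity, a THEOREM for compatible data
  have hy'P : j n (kolyvaginPoint (σ n) (n.primeFactors.erase ℓ) (f n) y₀) =
      j (n / ℓ) (kolyvaginPoint (σ (n / ℓ)) (n / ℓ).primeFactors (f (n / ℓ)) (y (n / ℓ))) := by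
    have hG1 : kolyvaginPoint (σ n) (n / ℓ).primeFactors (f n) y₀ =
        KolyvaginOperator.derivedPoint (pointGalHom W (ringClassField K ι n)) d.σ (n / ℓ) d.S y₀ :=
      KolyvaginH37Bridge.map_kolyvaginPoint_eq_derivedPoint (pointGalHom W (ringClassField K ι n)) (ρ n)
        (AddMonoidHom.id _) (fun g a ↦ hsmul n g a) hmsq
        (fun q hq ↦ hσn q (Nat.primeFactors_mono hdvd hn0 hq)) (f n) (hbij n d hfSn) y₀
    rw [hPm, hjn, ← primeFactors_div_eq_erase hn hℓp hℓn, hG1]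
    exact toGeomPoints_derivedPoint_map_of_compat hK ι hn hℓ hle d d₀ hσ hS₁ hS₂ hemb
  -- (β2): Prop. 3.7 (1) for the tree's data (PROVED trace relation)
  have hrel : grAct _ (traceElt (σ n ℓ) ℓ) (y n) = W.frobeniusTrace ℓ • y₀ := by
    have htr := HeegnerTrace.frobeniusTrace_smul_eq_of_lFunction_smul_eq hgoodp
      (HeegnerTrace.sum_pow_pointGalHom_y_eq_lFunction_smul_map hK ι hND hℓ (hinert ℓ hℓ)
        hℓN hℓm' hNn (Or.inr hD) d d₀ hle)
    rw [grAct_traceElt]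
    simp_rw [hsmul n, map_pow (ρ n), hσn ℓ hℓ, hyn]
    exact htr
  -- (γ): the labelled congruence for the pair, read through the dictionary
  have hES : ∀ [Fact ℓ.Prime] (hΔ : ¬ (ℓ : ℤ) ∣ minimalDiscriminantInt W)
      (φ₀ : absoluteGaloisGroup (ZMod ℓ)), (∀ x : AlgebraicClosure (ZMod ℓ), φ₀ • x = x ^ ℓ) →
      ∀ γ : ringClassGal ι n, geomReduction hΔ ((RatClosure.pointsEquiv (K := K) W).symm (j n (γ • y n))) =
        φ₀ • geomReduction hΔ ((RatClosure.pointsEquiv (K := K) W).symm (j n (γ • y₀))) := by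
    intro _ hΔ φ₀ hφ₀ γ
    rw [hjn, hsmul, hsmul, hyn]
    exact hγ hΔ φ₀ hφ₀ hle (ρ n γ) γ.2
  -- `hsplit`: Frobenius at `𝔓 ∣ λ` fixes `P(n/ℓ)` (`λ` splits completely in `K[n/ℓ]`)
  have hsplit : ∀ 𝔓 ∈ v.primesAbove, ∀ F : absoluteGaloisGroup K, IsArithFrobAt (𝓞 K) F 𝔓 →
      F • j (n / ℓ) (kolyvaginPoint (σ (n / ℓ)) (n / ℓ).primeFactors (f (n / ℓ)) (y (n / ℓ))) =
        j (n / ℓ) (kolyvaginPoint (σ (n / ℓ)) (n / ℓ).primeFactors (f (n / ℓ)) (y (n / ℓ))) :=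
    fun 𝔓 h𝔓 F hF ↦ hsplit_of_ringClassField_zhang (W := W) (p := 2) (M := M) hK ι σ
      (fun k ↦ k.primeFactors) H f y j e (hrat_of_galoisDictionary ι σ (fun k ↦ k.primeFactors) H f y π
        j hj' e ρ hρ hπρ') Rp n hn hkol ℓ hℓp hℓn ⟨rfl, rfl⟩ v hv 𝔓 h𝔓 F hF
  -- `hram` with the Frobenius clause: `D_𝔓 = I_𝔓 = ⟨σ_ℓ⟩` on `K[n]`
  have hram : ∀ 𝔓 ∈ v.primesAbove, ∃ τ₀ ∈ 𝔓.inertia (absoluteGaloisGroup K), π n τ₀ = σ n ℓ ∧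
      (∀ τ ∈ 𝔓.inertia (absoluteGaloisGroup K), ∃ i : ℕ, ∀ x ∈ (j n).range, τ • x = (τ₀ ^ i) • x) ∧
      (∀ F : absoluteGaloisGroup K, IsArithFrobAt (𝓞 K) F 𝔓 →
        ∃ i : ℕ, ∀ x ∈ (j n).range, F • x = (τ₀ ^ i) • x) := by
    intro 𝔓 h𝔓
    obtain ⟨τ₀, hτ₀I, hπτ₀, hIτ₀⟩ := hram_of_totallyRamified_at_zhang (W := W) (p := 2) (M := M) hK ι σ
      π j hj' e ρ hρ hπρ' Rp hσρ (htot_of_classFieldTheory_zhang (W := W) (p := 2) (M := M) hK ι e)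
      n hn hkol ℓ hℓp hℓn ⟨rfl, rfl⟩ v hv 𝔓 h𝔓
    refine ⟨τ₀, hτ₀I, hπτ₀, hIτ₀, fun F hF ↦ ?_⟩
    -- `F` fixes `K[n] ∩ K[n/ℓ]`, so `ρ_n (π_n F) ∈ G_ℓ = ρ_n(⟨σ_n ℓ⟩)`
    have hmem : ρ n (π n F) ∈ ringClassGalOver ι n (n / ℓ) := by
      rw [ringClassGalOver, mem_fixingSubgroup_iff]
      intro x hx
      rw [AlgEquiv.smul_def]
      have h := smul_algHom_ringClassField_eq_self_of_isArithFrobAt hK ι hm0 (e n) hvℓ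
        ((Nat.Prime.coprime_iff_not_dvd hℓp).mpr hℓm') h𝔓 hF hx
      rw [hπρ'] at h
      exact (e n).injective h
    rw [← hσρ n ℓ hℓ ⟨rfl, rfl⟩, Subgroup.mem_map] at hmem
    obtain ⟨g, hg, hgeq⟩ := hmem
    have hπF : π n F ∈ Subgroup.zpowers (σ n ℓ) := by rwa [← hρ n hgeq]
    have hfinord : IsOfFinOrder (σ n ℓ) := isOfFinOrder_of_finite _
    obtain ⟨i, hi⟩ := (hfinord.mem_powers_iff_mem_zpowers).mpr hπF
    have hi' : σ n ℓ ^ i = π n F := hi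
    refine ⟨i, ?_⟩
    rintro x ⟨a, rfl⟩
    rw [← hj', ← hj', map_pow, hπτ₀, hi']
  -- ### the END at `p = 2` (seat gk2-p2 g5), both conjuncts
  have hEND := zsmul_kolyvaginClass_localOrders_of_heegnerInputs (W := W) hK hℓK hℓM hℓv₀ hgood₀ hv hgood
    hdiv (σ n) n.primeFactors hℓ (hord n ℓ hℓ) (f n) (y n) y₀ (π n) (j n) (hj' n) (hA' n) (hPt' n)
    (hA' (n / ℓ)) (hPt' (n / ℓ)) hsel₂ hrel hy'P hES hsplit hram k
  -- the END's classes are the concrete classes `c_M(n)`, `c_M(n/ℓ)`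
  have hcn : d.kolyvaginClass Nat.prime_two M =
      kolyvaginClass (W.baseChange K) ((2 ^ M : ℕ) : ℤ) hdiv (hA' n)
        (j n (kolyvaginPoint (σ n) n.primeFactors (f n) (y n))) (hPt' n) := by
    rw [KolyvaginHeegnerData.kolyvaginClass_of_admissible _ Nat.prime_two M hA hPt]
    exact kolyvaginClass_congr (by rw [hjn]; rfl) hPn.symm
  have hcm : d₀.kolyvaginClass Nat.prime_two M =
      kolyvaginClass (W.baseChange K) ((2 ^ M : ℕ) : ℤ) hdiv (hA' (n / ℓ))
        (j (n / ℓ) (kolyvaginPoint (σ (n / ℓ)) (n / ℓ).primeFactors (f (n / ℓ)) (y (n / ℓ))))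
        (hPt' (n / ℓ)) := by
    rw [KolyvaginHeegnerData.kolyvaginClass_of_admissible _ Nat.prime_two M hA₀ hPt₀]
    exact kolyvaginClass_congr (by rw [hjm]; rfl) hPm.symm
  rw [hcn, hcm]
  exact hEND

end Summit.BirchSwinnertonDyer.BirchSwinnertonDyer.Theorems.GenusExact

end
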